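import Literature.Algebra.Homology.HyperExtExactFunctor
import Literature.Algebra.Homology.StupidFiltrationFunctor
import HarnessLib

/-!
# Exact functors commute with the connecting maps of the stupid filtration

For an exact functor `F : C ⥤ D` between abelian categories, an object `X : C` and a cochain
complex `K`, the connecting homomorphisms

  `δ : HyperExt X (σ≤n₀ K) k₀ → HyperExt X (Kⁿ¹[-n₁]) k₁`   (`n₀ + 1 = n₁`, `k₀ + 1 = k₁`)

of the short exact sequences `0 → Kⁿ¹[-n₁] → σ≤n₁ K → σ≤n₀ K → 0` of the stupid filtration
(`Literature/Algebra/Homology/StupidFiltration.lean`; for `K` a de Rham complex these are the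
differentials / extension data of the Hodge-to-de Rham spectral sequence) commute with the maps
induced by `F` on hyper-Ext (`HyperExt.mapExactFunctor`, file `HyperExtExactFunctor.lean`), once
`F(S_K)` is identified with `S_{F(K)}` (`mapStupidFiltrationShortComplexIso`, file
`StupidFiltrationFunctor.lean`): `map_mapExactFunctor_stupidFiltration_delta`. This is the
assembly of `HyperExt.mapExactFunctor_delta` with `HyperExt.delta_naturality`; everything is
proved.

## Why

With `F = j⁻¹` the restriction of abelian sheaves to an open subscheme (exact:
`Literature/Topology/SheafOpenRestriction.lean`), this is "the Hodge-to-de Rham connecting maps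
commute with restriction to an open", the formal part of comparing the degeneration statement
`Crystalline.HodgeDeRhamDegeneratesModTorsion` on `𝒳/W` with Deligne's degeneration theorem on the
generic fibre.

## References

* C. A. Weibel, *An introduction to homological algebra*, CUP 1994, 1.2.7, Example 10.4.9,
  Def. 10.7.1. [Weibel1994]
* P. Deligne, *Théorie de Hodge II*, Publ. Math. IHÉS 40 (1971), §1.4 (filtration bête and its
  functoriality). [folklore]
-/

universe w w' v v' u u'

open CategoryTheory Limits

namespace Literature.Algebra.Homology

namespace HyperExt

variable {C : Type u} [Category.{v} C] [Abelian C] {D : Type u'} [Category.{v'} D] [Abelian D]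
  (F : C ⥤ D) [F.Additive] [PreservesFiniteLimits F] [PreservesFiniteColimits F]
  (X : C) (K : CochainComplex C ℤ) (n₀ n₁ : ℤ) (h : n₀ + 1 = n₁)

set_option backward.isDefEq.respectTransparency false

/-- **Exact functors commute with the connecting homomorphisms of the stupid filtration.** For an
exact functor `F`, a complex `K` and the short exact sequences
`S_K : 0 → Kⁿ¹[-n₁] → σ≤n₁ K → σ≤n₀ K → 0`, `S_{F K}` of the stupid filtrations of `K` and `F(K)`
(identified with `F(S_K)` by `mapStupidFiltrationShortComplexIso`), the square
`HyperExt X (σ≤n₀ K) k₀ →δ HyperExt X (Kⁿ¹[-n₁]) k₁`, `HyperExt (F X) (σ≤n₀ F K) k₀ →δ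
HyperExt (F X) (F(K)ⁿ¹[-n₁]) k₁` commutes with the maps induced by `F`
(`mapExactFunctor_delta` and `delta_naturality`). The `HasHyperExt` hypotheses on the `D` side
are those of the three groups involved, in both spellings of `F(S_K)`. [folklore] -/
theorem map_mapExactFunctor_stupidFiltration_delta (k₀ k₁ : ℤ) (hk : k₀ + 1 = k₁)
    [HasHyperExt.{w} X (stupidFiltrationShortComplex K n₀ n₁ h).X₁]
    [HasHyperExt.{w} X (stupidFiltrationShortComplex K n₀ n₁ h).X₃]
    [h₁ : HasHyperExt.{w'} (F.obj X) ((F.mapHomologicalComplex (ComplexShape.up ℤ)).obj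
      (stupidFiltrationShortComplex K n₀ n₁ h).X₁)]
    [h₃ : HasHyperExt.{w'} (F.obj X) ((F.mapHomologicalComplex (ComplexShape.up ℤ)).obj
      (stupidFiltrationShortComplex K n₀ n₁ h).X₃)]
    [HasHyperExt.{w'} (F.obj X) (stupidFiltrationShortComplex
      ((F.mapHomologicalComplex (ComplexShape.up ℤ)).obj K) n₀ n₁ h).X₁]
    [HasHyperExt.{w'} (F.obj X) (stupidFiltrationShortComplex
      ((F.mapHomologicalComplex (ComplexShape.up ℤ)).obj K) n₀ n₁ h).X₃]
    (x : HyperExt.{w} X (stupidFiltrationShortComplex K n₀ n₁ h).X₃ k₀) :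
    haveI : HasHyperExt.{w'} (F.obj X) ((stupidFiltrationShortComplex K n₀ n₁ h).map
      (F.mapHomologicalComplex (ComplexShape.up ℤ))).X₁ := h₁
    map (mapStupidFiltrationShortComplexIso F K n₀ n₁ h).hom.τ₁ k₁
        (mapExactFunctor F k₁
          (delta (shortExact_stupidFiltrationShortComplex K n₀ n₁ h) k₀ k₁ hk x)) =
      delta (shortExact_stupidFiltrationShortComplex
          ((F.mapHomologicalComplex (ComplexShape.up ℤ)).obj K) n₀ n₁ h) k₀ k₁ hk
        (haveI : HasHyperExt.{w'} (F.obj X) ((stupidFiltrationShortComplex K n₀ n₁ h).map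
          (F.mapHomologicalComplex (ComplexShape.up ℤ))).X₃ := h₃
         map (mapStupidFiltrationShortComplexIso F K n₀ n₁ h).hom.τ₃ k₀
          (mapExactFunctor F k₀ x)) := by
  haveI i₁ : HasHyperExt.{w'} (F.obj X) ((stupidFiltrationShortComplex K n₀ n₁ h).map
    (F.mapHomologicalComplex (ComplexShape.up ℤ))).X₁ := h₁
  haveI i₃ : HasHyperExt.{w'} (F.obj X) ((stupidFiltrationShortComplex K n₀ n₁ h).map
    (F.mapHomologicalComplex (ComplexShape.up ℤ))).X₃ := h₃
  have hδ := mapExactFunctor_delta F (shortExact_stupidFiltrationShortComplex K n₀ n₁ h) k₀ k₁ hk x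
  have hnat := delta_naturality
    ((shortExact_stupidFiltrationShortComplex K n₀ n₁ h).map_of_exact
      (F.mapHomologicalComplex (ComplexShape.up ℤ)))
    (shortExact_stupidFiltrationShortComplex
      ((F.mapHomologicalComplex (ComplexShape.up ℤ)).obj K) n₀ n₁ h)
    (mapStupidFiltrationShortComplexIso F K n₀ n₁ h).hom k₀ k₁ hk (mapExactFunctor F k₀ x)
  exact (congrArg (map (mapStupidFiltrationShortComplexIso F K n₀ n₁ h).hom.τ₁ k₁) hδ).trans
    hnat.symm

end HyperExt

end Literature.Algebra.Homology
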